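import Summits.CriticalPhenomena.PercolationContinuityZ3.Theses.PercNonProliferation
import Literature.Probability.Percolation.GMFiniteSize
import Literature.Probability.Percolation.ConnectivityProofs
import Literature.Probability.Percolation.PercolationProofs

/-!
# `MeanCauchySchwarz` (route PercNonProliferation, item stmt-CriticalPhenomena-4450)

The free-box cousin of the Aizenman–Duminil-Copin–Sidoravicius density bound
(CMP 334 (2015), proof of Thm. 3.1; Aizenman, Nucl. Phys. B 485 (1997), App. A pattern), for bond
percolation on `ℤ³` at every density `p` and every scale `n`:

  `(θ(p) |B(n)|)² ≤ E_p[N_n] · E_p[S_n]`,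

where `B(n) = box 3 n`, `Λ = box 3 (2n)`, `S_n = #{(x,y) ∈ B(n)² : x ↔ y inside Λ}` and
`E_p[N_n] = ∑_{k < |B(n)|} P_p(∃ k+1 points of B(n), pairwise not joined inside Λ, each joined
inside Λ to ∂⁻Λ)` (which is the mean of the number `N_n` of spanning box-clusters met by `B(n)`).

## Proof

* Pointwise, for a configuration `ω ⊆ E(ℤ³)` (almost sure): let `P` be the set of percolating
  points of `B(n)` and `x ~ y` iff `x ↔ y` inside `Λ` (an equivalence relation on `P`). Every
  `x ∈ P` is joined inside `Λ` to `∂⁻Λ` (an infinite open lattice path leaves the finite box through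
  its inner boundary, `toBdry_of_percolatesAt`). If `P` splits into `m` classes, then
  representatives of any `k+1 ≤ m` classes witness the `k`-th spanning event, so `m ≤ N_n(ω)`
  (counted as `#{k < |B(n)| : k-th event holds}`), while Cauchy–Schwarz over the classes gives
  `|P|² = (∑_c |c|)² ≤ m ∑_c |c|² ≤ m · S_n(ω)`. Hence `V² ≤ N S` with `V = |P|`.
* From `V² ≤ N S` pointwise we get `2 t V ≤ N + t² S` for every `t ≥ 0`; integrating,
  `2 t E[V] ≤ E[N] + t² E[S]` for all `t ≥ 0`, whence `E[V]² ≤ E[N] E[S]` (take `t = E V / E S`).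
  No square roots, no `L²` theory: all three variables are finite sums of indicators.
* `E[V] = ∑_{x ∈ B(n)} θ_x(p) = |B(n)| θ(p)` by translation invariance
  (`theta_zdGraph_eq_theta_zero`); `E[N]` and `E[S]` are the two sums of probabilities in the
  statement (`integral_indicator_one`).

No FKG, no uniqueness, no ergodic theorem is used. Measurability of the spanning events: finite
Boolean combinations of the cylinder-determined events `openConnIn ↑(box 3 (2n)) x y`
(`DCT16.measurableSet_openConnIn`) over the countable index type `Fin (k+1) → Site 3`.

Tree API: `toBdry_of_percolatesAt` (GMFiniteSize), `DCT16.measurableSet_openConnIn`,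
`measurableSet_percolatesAt_holds`, `theta_zdGraph_eq_theta_zero`, `box_mono`.
Mathlib: `sq_sum_le_card_mul_sum_sq`, `Finset.card_eq_sum_card_image`,
`Finset.sum_fiberwise_of_maps_to'`, `integral_finsetSum`, `integral_indicator_one`,
`ProbabilityTheory.setBernoulli_ae_subset`.
-/

noncomputable section

namespace Summit.CriticalPhenomena.PercolationContinuityZ3.Theorems

open MeasureTheory ProbabilityTheory
open Literature.Probability.Percolation Literature.Probability.LatticeModels
open Summit.CriticalPhenomena.PercolationContinuityZ3.Theses.PercNonProliferation
open scoped Classical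

namespace MeanCauchySchwarz

/-! ### Classes of an equivalence relation on a finite set -/

section Classes

variable {α : Type*} [DecidableEq α] (P : Finset α) (r : α → α → Prop) [DecidableRel r]

omit [DecidableEq α] in
/-- Two related points of `P` have the same class `{z ∈ P | x ~ z}` (symmetry and transitivity
on `P`). -/
theorem filter_eq_filter_of_rel
    (hsymm : ∀ x ∈ P, ∀ y ∈ P, r x y → r y x)
    (htrans : ∀ x ∈ P, ∀ y ∈ P, ∀ z ∈ P, r x y → r y z → r x z)
    {x y : α} (hx : x ∈ P) (hy : y ∈ P) (hxy : r x y) :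
    P.filter (r x) = P.filter (r y) := by
  ext z
  simp only [Finset.mem_filter, and_congr_right_iff]
  intro hz
  exact ⟨fun h => htrans y hy x hx z hz (hsymm x hx y hy hxy) h,
    fun h => htrans x hx y hy z hz hxy h⟩

/-- The fibre of the class map `z ↦ {w ∈ P | z ~ w}` over the class of `x₀ ∈ P` is that class. -/
theorem filter_filter_eq_eq (hrefl : ∀ x ∈ P, r x x)
    (hsymm : ∀ x ∈ P, ∀ y ∈ P, r x y → r y x)
    (htrans : ∀ x ∈ P, ∀ y ∈ P, ∀ z ∈ P, r x y → r y z → r x z)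
    {x₀ : α} (hx₀ : x₀ ∈ P) :
    P.filter (fun z => P.filter (r z) = P.filter (r x₀)) = P.filter (r x₀) := by
  ext z
  simp only [Finset.mem_filter, and_congr_right_iff]
  intro hz
  constructor
  · intro h
    have hzz : z ∈ P.filter (r z) := Finset.mem_filter.2 ⟨hz, hrefl z hz⟩
    rw [h] at hzz
    exact (Finset.mem_filter.1 hzz).2
  · intro h
    exact (filter_eq_filter_of_rel P r hsymm htrans hx₀ hz h).symm

/-- **Cauchy–Schwarz over classes.** For a relation `r` that is an equivalence relation on the
finite set `P`, with `m` classes `{z ∈ P | x ~ z}`: `|P|² ≤ m · ∑_{x ∈ P} #{y ∈ P | x ~ y}`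
(the sum is `∑_classes |c|²`, and `(∑_c |c|)² ≤ m ∑_c |c|²`). -/
theorem card_sq_le_card_image_mul_sum (hrefl : ∀ x ∈ P, r x x)
    (hsymm : ∀ x ∈ P, ∀ y ∈ P, r x y → r y x)
    (htrans : ∀ x ∈ P, ∀ y ∈ P, ∀ z ∈ P, r x y → r y z → r x z) :
    P.card ^ 2 ≤ (P.image fun x => P.filter (r x)).card * ∑ x ∈ P, (P.filter (r x)).card := by
  set K := P.image (fun x => P.filter (r x)) with hK
  have hfib : ∀ c ∈ K, P.filter (fun z => P.filter (r z) = c) = c := by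
    intro c hc
    obtain ⟨x₀, hx₀, rfl⟩ := Finset.mem_image.1 hc
    exact filter_filter_eq_eq P r hrefl hsymm htrans hx₀
  have hcardP : P.card = ∑ c ∈ K, c.card := by
    rw [Finset.card_eq_sum_card_image (fun x => P.filter (r x)) P]
    exact Finset.sum_congr rfl fun c hc => by rw [hfib c hc]
  have hpairs : ∑ x ∈ P, (P.filter (r x)).card = ∑ c ∈ K, c.card ^ 2 := by
    calc ∑ x ∈ P, (P.filter (r x)).card
        = ∑ c ∈ K, ∑ x ∈ P with P.filter (r x) = c, c.card :=
          (Finset.sum_fiberwise_of_maps_to' (s := P) (t := K) (g := fun x => P.filter (r x))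
            (fun x hx => Finset.mem_image_of_mem _ hx) (fun c => c.card)).symm
      _ = ∑ c ∈ K, c.card ^ 2 := Finset.sum_congr rfl fun c hc => by
          rw [Finset.sum_const, smul_eq_mul, hfib c hc, sq]
  rw [hcardP, hpairs]
  exact sq_sum_le_card_mul_sum_sq

/-- **A transversal.** There is a family of `m` points of `P` (one in each class), pairwise not
related. -/
theorem exists_transversal
    (hsymm : ∀ x ∈ P, ∀ y ∈ P, r x y → r y x)
    (htrans : ∀ x ∈ P, ∀ y ∈ P, ∀ z ∈ P, r x y → r y z → r x z) :
    ∃ f : Fin (P.image fun x => P.filter (r x)).card → α,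
      (∀ i, f i ∈ P) ∧ ∀ i j, i ≠ j → ¬ r (f i) (f j) := by
  set K := P.image (fun x => P.filter (r x)) with hK
  have hmem : ∀ c : {c // c ∈ K}, ∃ x ∈ P, P.filter (r x) = c.1 := fun c =>
    Finset.mem_image.1 c.2
  choose g hgP hgC using hmem
  refine ⟨fun i => g (K.equivFin.symm i), fun i => hgP _, fun i j hij hr => hij ?_⟩
  have h1 : P.filter (r (g (K.equivFin.symm i))) = P.filter (r (g (K.equivFin.symm j))) :=
    filter_eq_filter_of_rel P r hsymm htrans (hgP _) (hgP _) hr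
  rw [hgC, hgC] at h1
  exact K.equivFin.symm.injective (Subtype.ext h1)

end Classes

/-! ### The pointwise count `V² ≤ N · S` -/

/-- **Pointwise count.** For a lattice configuration `ω ⊆ E(ℤ^d)` and `n ≤ m`: with
`P = {x ∈ B(n) : x ↔ ∞}`, `N = #{k < |B(n)| : some k+1 points of B(n) are pairwise not joined inside
B(m) and each joined inside B(m) to ∂⁻B(m)}` and the pair count
`S = ∑_{x ∈ B(n)} #{y ∈ B(n) : x ↔ y inside B(m)}`, one has `|P|² ≤ N · S` (maximal family of
pairwise-unjoined percolating points: every percolating point exits `B(m)` through `∂⁻B(m)`). -/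
theorem card_sq_le_card_mul_sum_card (d : ℕ) {n m : ℕ} (hnm : n ≤ m) {ω : BondConfig (Site d)}
    (hω : ω ⊆ (zdGraph d).edgeSet) :
    ((box d n).filter fun x => ω ∈ percolatesAt x).card ^ 2 ≤
      ((Finset.range (box d n).card).filter fun k => ∃ x : Fin (k + 1) → Site d,
          (∀ i, x i ∈ box d n) ∧
          (∀ i, ∃ y ∈ innerBoundary (zdGraph d) (box d m),
            ω ∈ openConnIn (↑(box d m) : Set (Site d)) (x i) y) ∧
          ∀ i j, i ≠ j → ω ∉ openConnIn (↑(box d m) : Set (Site d)) (x i) (x j)).card *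
      ∑ x ∈ box d n, ((box d n).filter fun y =>
          ω ∈ openConnIn (↑(box d m) : Set (Site d)) x y).card := by
  set B := box d n with hB
  set Λ : Set (Site d) := (↑(box d m) : Set (Site d)) with hΛ
  set P := B.filter (fun x => ω ∈ percolatesAt x) with hP
  set r : Site d → Site d → Prop := fun x y => ω ∈ openConnIn Λ x y with hr
  have hPB : ∀ x ∈ P, x ∈ B := fun x hx => (Finset.mem_filter.1 hx).1
  have hBΛ : ∀ x ∈ B, x ∈ Λ := fun x hx => Finset.mem_coe.2 (box_mono d hnm hx)
  have hrefl : ∀ x ∈ P, r x x := fun x hx =>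
    ⟨hBΛ x (hPB x hx), hBΛ x (hPB x hx), SimpleGraph.Reachable.refl _⟩
  have hsymm : ∀ x ∈ P, ∀ y ∈ P, r x y → r y x := by
    rintro x - y - ⟨hx, hy, h⟩
    exact ⟨hy, hx, h.symm⟩
  have htrans : ∀ x ∈ P, ∀ y ∈ P, ∀ z ∈ P, r x y → r y z → r x z := by
    rintro x - y - z - ⟨hx, _hy, h⟩ ⟨_hy', hz, h'⟩
    exact ⟨hx, hz, h.trans h'⟩
  have hA := card_sq_le_card_image_mul_sum P r hrefl hsymm htrans
  obtain ⟨f, hfP, hf⟩ := exists_transversal P r hsymm htrans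
  have hmB : (P.image fun x => P.filter (r x)).card ≤ B.card :=
    Finset.card_image_le.trans (Finset.card_filter_le _ _)
  have hsum : ∑ x ∈ P, (P.filter (r x)).card ≤ ∑ x ∈ B, (B.filter (r x)).card := by
    calc ∑ x ∈ P, (P.filter (r x)).card ≤ ∑ x ∈ P, (B.filter (r x)).card :=
          Finset.sum_le_sum fun x _ =>
            Finset.card_le_card (Finset.filter_subset_filter _ (Finset.filter_subset _ _))
      _ ≤ ∑ x ∈ B, (B.filter (r x)).card :=
          Finset.sum_le_sum_of_subset_of_nonneg (Finset.filter_subset _ _) fun _ _ _ => Nat.zero_le _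
  refine hA.trans (Nat.mul_le_mul ?_ hsum)
  calc (P.image fun x => P.filter (r x)).card
      = (Finset.range (P.image fun x => P.filter (r x)).card).card := (Finset.card_range _).symm
    _ ≤ _ := Finset.card_le_card fun k hk => ?_
  have hk' : k < (P.image fun x => P.filter (r x)).card := Finset.mem_range.1 hk
  refine Finset.mem_filter.2 ⟨Finset.mem_range.2 (lt_of_lt_of_le hk' hmB),
    fun i => f (Fin.castLE hk' i), fun i => hPB _ (hfP _), fun i => ?_,
    fun i j hij => hf _ _ fun h => hij (Fin.castLE_injective hk' h)⟩
  exact toBdry_of_percolatesAt (n := m) (box_mono d hnm (hPB _ (hfP _))) hω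
    (Finset.mem_filter.1 (hfP _)).2

/-! ### Measurability of the spanning events -/

/-- The event "some `k+1` points of `B(n)` are pairwise not joined inside `B(m)` and each joined
inside `B(m)` to `∂⁻B(m)`" is measurable (a countable Boolean combination of the cylinder events
`openConnIn ↑(box d m) x y`). -/
theorem measurableSet_spanningFamily (d n m k : ℕ) :
    MeasurableSet {ω : BondConfig (Site d) | ∃ x : Fin (k + 1) → Site d,
      (∀ i, x i ∈ box d n) ∧
      (∀ i, ∃ y ∈ innerBoundary (zdGraph d) (box d m),
        ω ∈ openConnIn (↑(box d m) : Set (Site d)) (x i) y) ∧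
      ∀ i j, i ≠ j → ω ∉ openConnIn (↑(box d m) : Set (Site d)) (x i) (x j)} := by
  have hO : ∀ a b : Site d,
      MeasurableSet (openConnIn (↑(box d m) : Set (Site d)) a b : Set (BondConfig (Site d))) :=
    fun a b => DCT16.measurableSet_openConnIn _ a b
  refine measurableSet_setOf.2 (Measurable.exists fun x => ?_)
  refine Measurable.and measurable_const (Measurable.and ?_ ?_)
  · refine Measurable.forall fun i => Measurable.exists fun y => ?_
    exact Measurable.and measurable_const (hO (x i) y).mem
  · refine Measurable.forall fun i => Measurable.forall fun j => ?_
    exact Measurable.imp measurable_const (hO (x i) (x j)).mem.not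

/-! ### From `V² ≤ N S` to `(E V)² ≤ E N · E S` -/

/-- `V² ≤ N S` with `V, N, S, t ≥ 0` gives `2 t V ≤ N + t² S`. -/
theorem two_mul_le_of_sq_le {V N S t : ℝ} (hV : 0 ≤ V) (hN : 0 ≤ N) (hS : 0 ≤ S) (ht : 0 ≤ t)
    (h : V ^ 2 ≤ N * S) : 2 * t * V ≤ N + t ^ 2 * S := by
  have h1 : (2 * t * V) ^ 2 ≤ (N + t ^ 2 * S) ^ 2 := by
    nlinarith [sq_nonneg (N - t ^ 2 * S), mul_nonneg (sq_nonneg t) (sub_nonneg.2 h)]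
  exact (sq_le_sq₀ (by positivity) (by positivity)).1 h1

/-- If `2 t v ≤ a + t² b` for all `t ≥ 0` (with `v, a, b ≥ 0`) then `v² ≤ a b`. -/
theorem sq_le_mul_of_forall {v a b : ℝ} (hv : 0 ≤ v) (ha : 0 ≤ a) (hb : 0 ≤ b)
    (h : ∀ t : ℝ, 0 ≤ t → 2 * t * v ≤ a + t ^ 2 * b) : v ^ 2 ≤ a * b := by
  rcases hb.eq_or_lt with hb0 | hbpos
  · have hv0 : v = 0 := by
      by_contra hne
      have hvpos : 0 < v := lt_of_le_of_ne hv (Ne.symm hne)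
      have hvne : v ≠ 0 := hvpos.ne'
      have h1 := h ((a + 1) / (2 * v)) (by positivity)
      have h2 : 2 * ((a + 1) / (2 * v)) * v = a + 1 := by
        field_simp
      rw [h2, ← hb0, mul_zero, add_zero] at h1
      linarith
    rw [hv0, ← hb0]
    simp
  · have hbne : b ≠ 0 := hbpos.ne'
    have h1 := h (v / b) (div_nonneg hv hb)
    have h2 : 2 * (v / b) * v = 2 * (v ^ 2 / b) := by ring
    have h3 : (v / b) ^ 2 * b = v ^ 2 / b := by
      field_simp
    rw [h2, h3] at h1
    have h4 : v ^ 2 / b ≤ a := by linarith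
    rw [div_le_iff₀ hbpos] at h4
    linarith

/-- **Integrated Cauchy–Schwarz without square roots**: if `V² ≤ N S` a.e. for nonnegative
integrable `V, N, S`, then `(∫ V)² ≤ (∫ N)(∫ S)`. -/
theorem sq_integral_le_mul_integral {α : Type*} [MeasurableSpace α] {μ : Measure α}
    {V N S : α → ℝ} (hVi : Integrable V μ) (hNi : Integrable N μ) (hSi : Integrable S μ)
    (hV : 0 ≤ᵐ[μ] V) (hN : 0 ≤ᵐ[μ] N) (hS : 0 ≤ᵐ[μ] S)
    (h : ∀ᵐ a ∂μ, V a ^ 2 ≤ N a * S a) :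
    (∫ a, V a ∂μ) ^ 2 ≤ (∫ a, N a ∂μ) * ∫ a, S a ∂μ := by
  refine sq_le_mul_of_forall (integral_nonneg_of_ae hV) (integral_nonneg_of_ae hN)
    (integral_nonneg_of_ae hS) fun t ht => ?_
  have hmono : ∫ a, 2 * t * V a ∂μ ≤ ∫ a, (N a + t ^ 2 * S a) ∂μ := by
    refine integral_mono_ae (hVi.const_mul (2 * t)) (hNi.add (hSi.const_mul (t ^ 2))) ?_
    filter_upwards [hV, hN, hS, h] with a haV haN haS ha
    exact two_mul_le_of_sq_le haV haN haS ht ha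
  rw [integral_const_mul, integral_add hNi (hSi.const_mul (t ^ 2)), integral_const_mul] at hmono
  exact hmono

/-- **The abstract mean inequality.** For a probability measure `μ`, a finite set `B`, events
`Pev x` of common probability `θ` (`x ∈ B`), events `R k` (`k ∈ Ks`) and `O x y`, all measurable:
if almost surely `#{x ∈ B : Pev x}² ≤ #{k ∈ Ks : R k} · ∑_{x∈B} #{y ∈ B : O x y}`, then
`(θ |B|)² ≤ (∑_k μ(R k)) · ∑_{x,y∈B} μ(O x y)`. -/
theorem sq_mul_card_le_of_ae {α ι κ : Type*} [MeasurableSpace α] (μ : Measure α)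
    [IsProbabilityMeasure μ] (B : Finset ι) (Ks : Finset κ)
    {Pev : ι → Set α} {R : κ → Set α} {O : ι → ι → Set α}
    (hP : ∀ x, MeasurableSet (Pev x)) (hR : ∀ k, MeasurableSet (R k))
    (hO : ∀ x y, MeasurableSet (O x y)) {θ : ℝ} (hθ : ∀ x ∈ B, μ.real (Pev x) = θ)
    (hpt : ∀ᵐ a ∂μ, ((B.filter fun x => a ∈ Pev x).card) ^ 2 ≤
        ((Ks.filter fun k => a ∈ R k).card) * ∑ x ∈ B, ((B.filter fun y => a ∈ O x y).card)) :
    (θ * (B.card : ℝ)) ^ 2 ≤ (∑ k ∈ Ks, μ.real (R k)) * ∑ x ∈ B, ∑ y ∈ B, μ.real (O x y) := by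
  -- the three random variables as sums of indicators
  have hVint1 : ∀ x, Integrable (fun a => (Pev x).indicator (1 : α → ℝ) a) μ := fun x =>
    (integrable_const (1 : ℝ)).indicator (hP x)
  have hNint1 : ∀ k, Integrable (fun a => (R k).indicator (1 : α → ℝ) a) μ := fun k =>
    (integrable_const (1 : ℝ)).indicator (hR k)
  have hSint1 : ∀ x y, Integrable (fun a => (O x y).indicator (1 : α → ℝ) a) μ := fun x y =>
    (integrable_const (1 : ℝ)).indicator (hO x y)
  have hVi : Integrable (fun a => ∑ x ∈ B, (Pev x).indicator (1 : α → ℝ) a) μ :=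
    integrable_finsetSum B fun x _ => hVint1 x
  have hNi : Integrable (fun a => ∑ k ∈ Ks, (R k).indicator (1 : α → ℝ) a) μ :=
    integrable_finsetSum Ks fun k _ => hNint1 k
  have hSi : Integrable (fun a => ∑ x ∈ B, ∑ y ∈ B, (O x y).indicator (1 : α → ℝ) a) μ :=
    integrable_finsetSum B fun x _ => integrable_finsetSum B fun y _ => hSint1 x y
  -- their means
  have hVint : ∫ a, (∑ x ∈ B, (Pev x).indicator (1 : α → ℝ) a) ∂μ = θ * B.card := by
    rw [integral_finsetSum B fun x _ => hVint1 x,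
      Finset.sum_congr rfl fun x hx => (integral_indicator_one (hP x)).trans (hθ x hx),
      Finset.sum_const, nsmul_eq_mul, mul_comm]
  have hNint : ∫ a, (∑ k ∈ Ks, (R k).indicator (1 : α → ℝ) a) ∂μ = ∑ k ∈ Ks, μ.real (R k) := by
    rw [integral_finsetSum Ks fun k _ => hNint1 k]
    exact Finset.sum_congr rfl fun k _ => integral_indicator_one (hR k)
  have hSint : ∫ a, (∑ x ∈ B, ∑ y ∈ B, (O x y).indicator (1 : α → ℝ) a) ∂μ =
      ∑ x ∈ B, ∑ y ∈ B, μ.real (O x y) := by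
    rw [integral_finsetSum B fun x _ => integrable_finsetSum B fun y _ => hSint1 x y]
    refine Finset.sum_congr rfl fun x _ => ?_
    rw [integral_finsetSum B fun y _ => hSint1 x y]
    exact Finset.sum_congr rfl fun y _ => integral_indicator_one (hO x y)
  rw [← hVint, ← hNint, ← hSint]
  have h01 : ∀ (s : Set α) (a : α), 0 ≤ s.indicator (1 : α → ℝ) a := fun s a =>
    Set.indicator_nonneg (fun _ _ => zero_le_one) a
  refine sq_integral_le_mul_integral hVi hNi hSi
    (ae_of_all _ fun a => Finset.sum_nonneg fun x _ => h01 _ a)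
    (ae_of_all _ fun a => Finset.sum_nonneg fun k _ => h01 _ a)
    (ae_of_all _ fun a => Finset.sum_nonneg fun x _ => Finset.sum_nonneg fun y _ => h01 _ a) ?_
  filter_upwards [hpt] with a ha
  simp only [Set.indicator_apply, Pi.one_apply, Finset.sum_boole]
  exact_mod_cast ha

end MeanCauchySchwarz

/-- **`MeanCauchySchwarz`** (item stmt-CriticalPhenomena-4450): for bond percolation on `ℤ³`, every
`p` and `n`, `(θ(p)|B(n)|)² ≤ E_p[N_n] · E_p[S_n]`, where `E_p[N_n]` is the sum over `k < |B(n)|`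
of the probabilities of the `k`-th spanning-family event in `B(2n)` and `E_p[S_n]` the expected
number of ordered pairs of `B(n)` joined inside `B(2n)` (free-box cousin of the
Aizenman–Duminil-Copin–Sidoravicius density bound; pointwise `V² ≤ N S` a.s., then an
integrated Cauchy–Schwarz; no FKG, uniqueness or ergodic theorem). -/
theorem meanCauchySchwarz_proof : MeanCauchySchwarz := by
  unfold MeanCauchySchwarz
  intro p n
  refine MeanCauchySchwarz.sq_mul_card_le_of_ae (bondPercolation (zdGraph 3) p) (box 3 n)
    (Finset.range (box 3 n).card) (fun x => measurableSet_percolatesAt_holds x)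
    (fun k => MeanCauchySchwarz.measurableSet_spanningFamily 3 n (2 * n) k)
    (fun x y => DCT16.measurableSet_openConnIn _ x y)
    (fun x _ => theta_zdGraph_eq_theta_zero p x) ?_
  filter_upwards [(setBernoulli_ae_subset :
    ∀ᵐ ω ∂(bondPercolation (zdGraph 3) p), ω ⊆ (zdGraph 3).edgeSet)] with ω hω
  exact MeanCauchySchwarz.card_sq_le_card_mul_sum_card 3 (by omega) hω

end Summit.CriticalPhenomena.PercolationContinuityZ3.Theorems
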